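import Literature.NumberTheory.LFunctions.SuzukiStructureFunctions
import Literature.Analysis.DeBrangesSpaces.Basic
import Literature.Analysis.Complex.StripResidueFormula
import HarnessLib

/-!
# SuzukiStructureFunctionsBasic — Suzuki's structure functions `E(t,z) = A(t,z) − iB(t,z)` (JFA21 §3.6):
# the definitional layer, the `t ≤ 0` layer, Prop. 3.3 and `E(0,z) = E(z)` (column DBR; RH-FREE)

LINE 1 — LABEL: RH-FREE (identities for ANY Suzuki pair `(ϱ, K)`; no `ζ`, no zeros, no positivity);
bears_on LADDER-RH B-D → B-P(P1)/(P3) (the column's de Branges object `E(t,z)` on clean windows, typed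
AS PRINTED in `Literature/NumberTheory/LFunctions/SuzukiStructureFunctions.lean`, p483341).
WHAT THIS IS NOT: not progress toward RH; `E(t,·) ∈ HB̄` for the `ζ` data as `ω → 0` is Suzuki's Thm 2.4
(GRH-equivalent) and is neither typed as a target nor claimed here; nothing here bears on the truth of RH.

Source: M. Suzuki, *Hamiltonians arising from L-functions in the Selberg class*, J. Funct. Anal. 281 (2021)
109116 = arXiv:1606.05726 [Suzuki2021Hamiltonians], §3.6 (3.26)–(3.41), Prop. 3.3, Thm. 3.1 (5).

Contents (seat rh-dbr-eng-5 g7):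
* §1 definitional layer: `m_pos`, `gamma_pos`, `hamiltonian_det` (`det H(t) = 1`), `hamiltonian_posDef`
  (`H(t) ∈ Sym₂⁺(ℝ)`), `frakF_eq`/`frakG_eq` ((3.26) as printed), `neg_I_mul_frakB` ((3.27) as printed),
  `structE_eq` (`E(t,z) = m(t)·𝖥𝔉(t,·)(z) + m(t)⁻¹·𝖥𝔊(t,·)(z)`);
* §2 Suzuki's transform `𝖥f(z) = ∫ f(x)e^{izx} dx`: `fourier_comp_sub` (translation), `fourier_comp_neg`
  (reflection), `sharp_fourier` (`(𝖥f)♯(z) = (𝖥f)(−z)`, i.e. «`E♯(z) = E(−z)` from (K1)»),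
  `integrable_mul_cexp_of_decay` (super-exponential decay ⇒ `𝖥f` converges absolutely on all of `ℂ`);
* §3 the `t ≤ 0` layer under (K3): `suzukiPhiExt_eq_of_nonpos` (`φ^ε(t,x) = K(x+t)`), `mu_eq_zero_of_nonpos`,
  `m_eq_one_of_nonpos`, `hamiltonian_eq_one_of_nonpos` («`m(t) = 1` for `t ≤ 0`»);
* §4 Prop. 3.3 (3.31) `frakF_zero`/`frakG_zero` (`𝔉(0,x) = ½(ϱ(x)+ϱ(−x))`, `𝔊(0,x) = ½(ϱ(x)−ϱ(−x))`), and for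
  `t ≤ 0`: `frakFG_of_nonpos`, **`structE_of_nonpos`** (`E(t,z) = e^{izt}·E(z)`, the display after Thm. 3.1)
  and **`structE_zero`** (Thm. 3.1 (5) / (3.41): `E(0,z) = E(z)` with `E = 𝖥ϱ`).
The window-level theory (Lemma 3.7, (3.9), Prop. 3.1, Cor. 3.1) is in the companion files
`SuzukiStructureFunctionsConvolution` / `SuzukiStructureFunctionsParity`.
-/

noncomputable section

-- D-0017: `Summit.<S>.<S>.…` is the designed namespace of a single-problem summit.
set_option linter.dupNamespace false

open MeasureTheory Set Complex Filter Topology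
open scoped ComplexConjugate

namespace Summit.RiemannHypothesis.RiemannHypothesis.Theorems.SuzukiStructureFunctions

open Literature.NumberTheory.LFunctions Literature.NumberTheory.LFunctions.SuzukiStructure
open Literature.Analysis.DeBrangesSpaces (sharp)

variable {ϱ K : ℝ → ℝ} {ε t : ℝ}

/-! ## §1 The definitional layer: `m > 0`, `det H = 1`, `H ≻ 0`, `E = m·𝖥𝔉 + m⁻¹·𝖥𝔊` -/

/-- RH-FREE. `m(t) > 0` («`m(t)` is a continuous positive real-valued function»). -/
theorem m_pos (K : ℝ → ℝ) (t : ℝ) : 0 < m K t := Real.exp_pos _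

/-- RH-FREE. `m(t) ≠ 0`. -/
theorem m_ne_zero (K : ℝ → ℝ) (t : ℝ) : m K t ≠ 0 := (m_pos K t).ne'

/-- RH-FREE. `m(0) = 1`. -/
theorem m_zero (K : ℝ → ℝ) : m K 0 = 1 := by
  simp [m]

/-- RH-FREE. `γ(t) > 0`. -/
theorem gamma_pos (K : ℝ → ℝ) (t : ℝ) : 0 < gamma K t := pow_pos (m_pos K t) 2

/-- RH-FREE. `γ(0) = 1`. -/
theorem gamma_zero (K : ℝ → ℝ) : gamma K 0 = 1 := by
  simp [gamma, m_zero]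

/-- RH-FREE. `det H(t) = 1` for every `t` («Hamiltonians of determinant one», (3.33)). -/
theorem hamiltonian_det (K : ℝ → ℝ) (t : ℝ) : (hamiltonian K t).det = 1 := by
  rw [hamiltonian, Matrix.det_fin_two_of, mul_zero, sub_zero, one_div, inv_mul_cancel₀ (gamma_pos K t).ne']

/-- RH-FREE. `H(t)` is positive definite for every `t` («`Sym₂⁺(ℝ)`-valued», (3.33)). -/
theorem hamiltonian_posDef (K : ℝ → ℝ) (t : ℝ) : (hamiltonian K t).PosDef := by
  have hpos := gamma_pos K t
  have hdiag : hamiltonian K t = Matrix.diagonal ![1 / gamma K t, gamma K t] := by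
    ext i j
    fin_cases i <;> fin_cases j <;> simp [hamiltonian, Matrix.diagonal]
  rw [hdiag, Matrix.posDef_diagonal_iff]
  intro i
  fin_cases i
  · simpa using one_div_pos.mpr hpos
  · simpa using hpos

/-- RH-FREE. `𝔉` as printed (3.26). -/
theorem frakF_eq (ϱ K : ℝ → ℝ) (t x : ℝ) :
    frakF ϱ K t x = 1 / 2 * (ϱ (x - t) + ∫ y in Ioi t, ϱ (x - y) * suzukiPhiExt K 1 t y) := by
  simp [frakF, frakFG]

/-- RH-FREE. `𝔊` as printed (3.26). -/
theorem frakG_eq (ϱ K : ℝ → ℝ) (t x : ℝ) :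
    frakG ϱ K t x = 1 / 2 * (ϱ (x - t) - ∫ y in Ioi t, ϱ (x - y) * suzukiPhiExt K (-1) t y) := by
  simp [frakG, frakFG, sub_eq_add_neg]

/-- RH-FREE. `−i𝔅(t,z) = ∫ 𝔊(t,x) e^{izx} dx`, as printed (3.27). -/
theorem neg_I_mul_frakB (ϱ K : ℝ → ℝ) (t : ℝ) (z : ℂ) :
    -I * frakB ϱ K t z = fourier (frakG ϱ K t) z := by
  rw [frakB, ← mul_assoc, neg_mul, I_mul_I, neg_neg, one_mul]

/-- RH-FREE. `E(t,z) = m(t)·∫𝔉(t,x)e^{izx} dx + m(t)⁻¹·∫𝔊(t,x)e^{izx} dx` ((3.27), (3.38), (3.39):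
`A − iB = m𝔄 + m⁻¹(−i𝔅)`). -/
theorem structE_eq (ϱ K : ℝ → ℝ) (t : ℝ) (z : ℂ) :
    structE ϱ K t z =
      (m K t : ℂ) * fourier (frakF ϱ K t) z + ((m K t)⁻¹ : ℝ) * fourier (frakG ϱ K t) z := by
  rw [structE, structA, structB, frakA, frakB]
  have hI : I * (((m K t)⁻¹ : ℝ) * (I * fourier (frakG ϱ K t) z)) =
      -(((m K t)⁻¹ : ℝ) * fourier (frakG ϱ K t) z) := by
    calc I * (((m K t)⁻¹ : ℝ) * (I * fourier (frakG ϱ K t) z))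
        = (I * I) * (((m K t)⁻¹ : ℝ) * fourier (frakG ϱ K t) z) := by ring
      _ = -(((m K t)⁻¹ : ℝ) * fourier (frakG ϱ K t) z) := by rw [I_mul_I]; ring
  rw [hI, sub_neg_eq_add]

/-! ## §2 Suzuki's transform `𝖥`: translation, reflection, conjugate reflection, integrability under decay -/

/-- RH-FREE. `𝖥` of a translate: `∫ f(x−a)e^{izx} dx = e^{iza}·(𝖥f)(z)`. -/
theorem fourier_comp_sub (f : ℝ → ℝ) (a : ℝ) (z : ℂ) :
    fourier (fun x => f (x - a)) z = cexp (I * z * a) * fourier f z := by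
  rw [fourier_def, fourier_def, ← integral_const_mul,
    ← integral_sub_right_eq_self (μ := (volume : Measure ℝ))
      (fun x : ℝ => cexp (I * z * a) * ((f x : ℂ) * cexp (I * z * x))) a]
  refine integral_congr_ae (Eventually.of_forall fun x => ?_)
  simp only
  have hne := Complex.exp_ne_zero (I * z * a)
  rw [show I * z * ((x - a : ℝ) : ℂ) = I * z * x + -(I * z * a) by push_cast; ring, Complex.exp_add,
    Complex.exp_neg]
  field_simp

/-- RH-FREE. `𝖥` of the reflection: `∫ f(−x)e^{izx} dx = (𝖥f)(−z)`. -/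
theorem fourier_comp_neg (f : ℝ → ℝ) (z : ℂ) :
    fourier (fun x => f (-x)) z = fourier f (-z) := by
  rw [fourier_def, fourier_def]
  have h := integral_neg_eq_self (μ := (volume : Measure ℝ)) (fun x : ℝ => (f x : ℂ) * cexp (I * (-z) * x))
  rw [← h]
  refine integral_congr_ae (Eventually.of_forall fun x => ?_)
  simp only
  congr 1
  push_cast
  ring_nf

/-- RH-FREE. **`(𝖥f)♯(z) = (𝖥f)(−z)` for real `f`** («we have `E♯(z) = E(−z)` from (K1)»): the conjugate
reflection `sharp` of `Literature.Analysis.DeBrangesSpaces`. -/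
theorem sharp_fourier (f : ℝ → ℝ) (z : ℂ) : sharp (fourier f) z = fourier f (-z) := by
  rw [Literature.Analysis.DeBrangesSpaces.sharp_apply, fourier_def, fourier_def, ← integral_conj]
  refine integral_congr_ae (Eventually.of_forall fun x => ?_)
  simp only [map_mul, Complex.conj_ofReal, ← Complex.exp_conj, Complex.conj_I, Complex.conj_conj]
  congr 2
  ring

/-- RH-FREE. `‖e^{izx}‖ ≤ e^{|Im z|·|x|}` for real `x`. -/
theorem norm_cexp_I_mul_le (z : ℂ) (x : ℝ) : ‖cexp (I * z * x)‖ ≤ Real.exp (|z.im| * |x|) := by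
  rw [Complex.norm_exp, Real.exp_le_exp]
  have hre : (I * z * (x : ℂ)).re = -(z.im * x) := by
    simp [Complex.mul_re, Complex.mul_im]
  rw [hre]
  calc -(z.im * x) ≤ |z.im * x| := neg_le_abs _
    _ = |z.im| * |x| := abs_mul _ _

/-- RH-FREE. **Super-exponential decay ⇒ `f·e^{iz·}` is integrable for every complex `z`** (so `𝖥f` is an
honest integral everywhere; used for `ϱ` of (K1) and for `𝔉(t,·)`, `𝔊(t,·)`). -/
theorem integrable_mul_cexp_of_decay {f : ℝ → ℝ} (hf : Continuous f)
    (hdec : ∀ n : ℝ, ∃ C : ℝ, ∀ x : ℝ, |f x| ≤ C * Real.exp (-(n * |x|))) (z : ℂ) :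
    Integrable fun x : ℝ => (f x : ℂ) * cexp (I * z * x) := by
  obtain ⟨C, hC⟩ := hdec (|z.im| + 1)
  have hmeas : AEStronglyMeasurable (fun x : ℝ => (f x : ℂ) * cexp (I * z * x)) volume :=
    (Continuous.aestronglyMeasurable (by fun_prop))
  refine Integrable.mono' ((Literature.Analysis.Complex.integrable_exp_neg_mul_abs one_pos).const_mul C)
    hmeas (Eventually.of_forall fun x => ?_)
  rw [norm_mul, Complex.norm_real, Real.norm_eq_abs]
  calc |f x| * ‖cexp (I * z * x)‖
      ≤ C * Real.exp (-((|z.im| + 1) * |x|)) * Real.exp (|z.im| * |x|) :=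
        mul_le_mul (hC x) (norm_cexp_I_mul_le z x) (norm_nonneg _)
          ((abs_nonneg _).trans (hC x))
    _ = C * Real.exp (-1 * |x|) := by
        rw [mul_assoc, ← Real.exp_add]
        congr 2
        ring

/-- RH-FREE. Decay is inherited by translates: `|f(x)| ≤ C_n e^{−n|x|}` ⇒ `|f(x−a)| ≤ C_n e^{n|a|} e^{−n|x|}`. -/
theorem decay_comp_sub {f : ℝ → ℝ} (hdec : ∀ n : ℝ, ∃ C : ℝ, ∀ x : ℝ, |f x| ≤ C * Real.exp (-(n * |x|)))
    (a : ℝ) : ∀ n : ℝ, ∃ C : ℝ, ∀ x : ℝ, |f (x - a)| ≤ C * Real.exp (-(n * |x|)) := by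
  intro n
  obtain ⟨C, hC⟩ := hdec |n|
  refine ⟨C * Real.exp (|n| * |a|), fun x => (hC (x - a)).trans ?_⟩
  have hC0 : 0 ≤ C := by
    have := (abs_nonneg _).trans (hC 0)
    simpa using this
  rw [mul_assoc, ← Real.exp_add]
  refine mul_le_mul_of_nonneg_left (Real.exp_le_exp.2 ?_) hC0
  have h1 : |x| ≤ |x - a| + |a| := by
    have := abs_add_le (x - a) a
    simpa using this
  have h2 : n * |x| ≤ |n| * |x| := mul_le_mul_of_nonneg_right (le_abs_self n) (abs_nonneg x)
  nlinarith [abs_nonneg n, abs_nonneg (x - a), abs_nonneg a, abs_nonneg x]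

/-- RH-FREE. Decay is inherited by the reflection `x ↦ f(−x)`. -/
theorem decay_comp_neg {f : ℝ → ℝ} (hdec : ∀ n : ℝ, ∃ C : ℝ, ∀ x : ℝ, |f x| ≤ C * Real.exp (-(n * |x|))) :
    ∀ n : ℝ, ∃ C : ℝ, ∀ x : ℝ, |f (-x)| ≤ C * Real.exp (-(n * |x|)) := by
  intro n
  obtain ⟨C, hC⟩ := hdec n
  exact ⟨C, fun x => by simpa [abs_neg] using hC (-x)⟩

/-! ## §3 The `t ≤ 0` layer under (K3): `φ^ε(t,x) = K(x+t)`, `μ = 0`, `m = 1`, `H = 1` -/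

/-- RH-FREE. Under (K3), for `t ≤ 0` the zero function solves (3.4) (`K(x+t) = 0` for `x ≤ t ≤ 0`), so the
window is solvable («`𝖪[t] = 0` for `t ≤ 0`»). -/
theorem exists_isSuzukiPhiSolution_of_nonpos (hK0 : ∀ u : ℝ, u ≤ 0 → K u = 0) (ε : ℝ) (ht : t ≤ 0) :
    ∃ X : ℝ → ℝ, IsSuzukiPhiSolution K ε t X := by
  refine ⟨fun _ => 0, MemLp.zero, fun x hx => ?_⟩
  simp [hK0 (x + t) (by linarith)]

/-- RH-FREE. **Under (K3), `φ^ε(t,x) = K(x+t)` for every `t ≤ 0` and every real `x`** (the convention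
`φ^ε(0,x) = K(x)` after (3.7), here for all `t ≤ 0`: on `(−∞,t]` equation (3.4) forces the solution to
vanish, and (3.7) returns `K(x+t)`). -/
theorem suzukiPhiExt_eq_of_nonpos (hK0 : ∀ u : ℝ, u ≤ 0 → K u = 0) (ε : ℝ) (ht : t ≤ 0) (x : ℝ) :
    suzukiPhiExt K ε t x = K (x + t) := by
  have h := exists_isSuzukiPhiSolution_of_nonpos hK0 ε ht
  have hsol := isSuzukiPhiSolution_suzukiPhiExt h
  -- on `(−∞,t]` the solution vanishes
  have hzero : ∀ y, y ≤ t → suzukiPhiExt K ε t y = 0 := by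
    intro y hy
    have hy' := hsol.2 y hy
    rw [hK0 (y + t) (by linarith), setIntegral_eq_zero_of_forall_eq_zero (fun w hw => ?_)] at hy'
    · simpa using hy'
    · rw [hK0 (y + w) (by simp only [mem_Iic] at hw; linarith), zero_mul]
  rw [suzukiPhiExt_eq h x, setIntegral_eq_zero_of_forall_eq_zero (fun w hw => ?_)]
  · simp
  · rw [hzero w hw, mul_zero]

/-- RH-FREE. Under (K3), `μ(t) = 0` for `t < 0`. -/
theorem mu_eq_zero_of_neg (hK3 : ∀ u : ℝ, u < 0 → K u = 0) (ht : t < 0) : mu K t = 0 := by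
  rw [mu, suzukiPhiExt_eq_zero_of_lt_neg hK3 (by linarith : t < -t),
    suzukiPhiExt_eq_zero_of_lt_neg hK3 (by linarith : t < -t), add_zero]

/-- RH-FREE. Under (K3) (with `K(0) = 0`), `μ(t) = 2K(2t) = 0` for `t ≤ 0`, in particular `μ(0) = 0`
(«`lim_{t→0⁺} μ(t) = 0`»). -/
theorem mu_eq_zero_of_nonpos (hK0 : ∀ u : ℝ, u ≤ 0 → K u = 0) (ht : t ≤ 0) : mu K t = 0 := by
  rw [mu, suzukiPhiExt_eq_of_nonpos hK0 1 ht, suzukiPhiExt_eq_of_nonpos hK0 (-1) ht,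
    hK0 (t + t) (by linarith), add_zero]

/-- RH-FREE. **Under (K3), `m(t) = 1` for `t ≤ 0`** («this also holds for `t ≤ 0` if we define `m(t) = 1`
for `t ≤ 0`, since `𝖪[t] = 0` for `t ≤ 0` and `m(0) = 1`», after (3.35)). -/
theorem m_eq_one_of_nonpos (hK3 : ∀ u : ℝ, u < 0 → K u = 0) (ht : t ≤ 0) : m K t = 1 := by
  rw [m, Real.exp_eq_one_iff]
  have h0 : ∀ᵐ s : ℝ, s ≠ 0 := by
    have : ({0}ᶜ : Set ℝ) ∈ ae (volume : Measure ℝ) := compl_mem_ae_iff.mpr (measure_singleton 0)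
    filter_upwards [this] with s hs
    simpa using hs
  refine intervalIntegral.integral_zero_ae ?_
  filter_upwards [h0] with s hs hmem
  rw [uIoc_of_ge ht] at hmem
  exact mu_eq_zero_of_neg hK3 (lt_of_le_of_ne hmem.2 hs)

/-- RH-FREE. Under (K3), `γ(t) = 1` for `t ≤ 0`. -/
theorem gamma_eq_one_of_nonpos (hK3 : ∀ u : ℝ, u < 0 → K u = 0) (ht : t ≤ 0) : gamma K t = 1 := by
  rw [gamma, m_eq_one_of_nonpos hK3 ht, one_pow]

/-- RH-FREE. **Under (K3), `H(t) = 1` for `t ≤ 0`** («the Hamiltonian is extended to `(−∞,τ)` by defining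
`m(t) = 1` for `t < 0`»). -/
theorem hamiltonian_eq_one_of_nonpos (hK3 : ∀ u : ℝ, u < 0 → K u = 0) (ht : t ≤ 0) :
    hamiltonian K t = 1 := by
  rw [hamiltonian, gamma_eq_one_of_nonpos hK3 ht]
  ext i j
  fin_cases i <;> fin_cases j <;> simp

/-! ## §4 Prop. 3.3 and (3.41): the structure functions at `t ≤ 0`

Under (K2)–(K3) in the time domain (`ϱ∗K = ϱ(−·)`, `K = 0` on `(−∞,0]`):
`𝔉(t,x) = ½(ϱ(x−t) + ϱ(−x−t))`, `𝔊(t,x) = ½(ϱ(x−t) − ϱ(−x−t))` for `t ≤ 0` — at `t = 0` this is (3.31) —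
and `E(t,z) = e^{izt}E(z)`, `A(t,z) = ½(E(z)e^{itz} + E♯(z)e^{−itz})`, `B(t,z) = (i/2)(E(z)e^{itz} − E♯(z)e^{−itz})`
(the display after Thm. 3.1), in particular `E(0,z) = E(z)`, `A(0,z) = A(z)`, `B(0,z) = B(z)` (3.41). -/

/-- RH-FREE. The convolution identity (K2) shifted: `∫_{(t,∞)} ϱ(x−y)K(y+t) dy = ϱ(−x−t)` for `t ≤ 0`
(the integrand vanishes for `y ≤ t` by (K3); substitute `v = y + t`). -/
theorem setIntegral_Ioi_rho_mul_kernel_of_nonpos (hK0 : ∀ u : ℝ, u ≤ 0 → K u = 0)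
    (hconv : ∀ x : ℝ, ∫ y : ℝ, ϱ (x - y) * K y = ϱ (-x)) (ht : t ≤ 0) (x : ℝ) :
    ∫ y in Ioi t, ϱ (x - y) * K (y + t) = ϱ (-x - t) := by
  rw [setIntegral_eq_integral_of_forall_compl_eq_zero (fun y hy => ?_)]
  · have h := integral_add_right_eq_self (μ := (volume : Measure ℝ)) (fun v : ℝ => ϱ (x + t - v) * K v) t
    have e : (fun y : ℝ => ϱ (x - y) * K (y + t)) = fun y => ϱ (x + t - (y + t)) * K (y + t) := by
      funext y; ring_nf
    rw [e, h, hconv (x + t)]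
    ring_nf
  · simp only [mem_Ioi, not_lt] at hy
    rw [hK0 (y + t) (by linarith), mul_zero]

/-- RH-FREE. **For `t ≤ 0`: `frakFG ε (t,x) = ½(ϱ(x−t) + ε·ϱ(−x−t))`** — hence `𝔉(t,x) = ½(ϱ(x−t)+ϱ(−x−t))`
and `𝔊(t,x) = ½(ϱ(x−t)−ϱ(−x−t))`; at `t = 0` this is Prop. 3.3 (3.31). -/
theorem frakFG_of_nonpos (hK0 : ∀ u : ℝ, u ≤ 0 → K u = 0)
    (hconv : ∀ x : ℝ, ∫ y : ℝ, ϱ (x - y) * K y = ϱ (-x)) (ε : ℝ) (ht : t ≤ 0) (x : ℝ) :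
    frakFG ϱ K ε t x = 1 / 2 * (ϱ (x - t) + ε * ϱ (-x - t)) := by
  rw [frakFG]
  have e : (fun y : ℝ => ϱ (x - y) * suzukiPhiExt K ε t y) = fun y => ϱ (x - y) * K (y + t) := by
    funext y; rw [suzukiPhiExt_eq_of_nonpos hK0 ε ht y]
  rw [e, setIntegral_Ioi_rho_mul_kernel_of_nonpos hK0 hconv ht x]

/-- RH-FREE. **Prop. 3.3 (3.31), first half: `𝔉(0,x) = ½(ϱ(x) + ϱ(−x))`.** -/
theorem frakF_zero (hK0 : ∀ u : ℝ, u ≤ 0 → K u = 0)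
    (hconv : ∀ x : ℝ, ∫ y : ℝ, ϱ (x - y) * K y = ϱ (-x)) (x : ℝ) :
    frakF ϱ K 0 x = 1 / 2 * (ϱ x + ϱ (-x)) := by
  rw [frakF, frakFG_of_nonpos hK0 hconv 1 le_rfl x]
  simp

/-- RH-FREE. **Prop. 3.3 (3.31), second half: `𝔊(0,x) = ½(ϱ(x) − ϱ(−x))`.** -/
theorem frakG_zero (hK0 : ∀ u : ℝ, u ≤ 0 → K u = 0)
    (hconv : ∀ x : ℝ, ∫ y : ℝ, ϱ (x - y) * K y = ϱ (-x)) (x : ℝ) :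
    frakG ϱ K 0 x = 1 / 2 * (ϱ x - ϱ (-x)) := by
  rw [frakG, frakFG_of_nonpos hK0 hconv (-1) le_rfl x]
  ring

/-- RH-FREE. For `t ≤ 0`, `𝔉(t,x) + 𝔊(t,x) = ϱ(x−t)`. -/
theorem frakF_add_frakG_of_nonpos (hK0 : ∀ u : ℝ, u ≤ 0 → K u = 0)
    (hconv : ∀ x : ℝ, ∫ y : ℝ, ϱ (x - y) * K y = ϱ (-x)) (ht : t ≤ 0) (x : ℝ) :
    frakF ϱ K t x + frakG ϱ K t x = ϱ (x - t) := by
  rw [frakF, frakG, frakFG_of_nonpos hK0 hconv 1 ht x, frakFG_of_nonpos hK0 hconv (-1) ht x]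
  ring

/-- RH-FREE. **`E(t,z) = e^{izt}·E(z)` for `t ≤ 0`**, where `E = 𝖥ϱ` (K1) (the display after Thm. 3.1:
`A(t,z) − iB(t,z) = E(z)e^{itz}` for the extended Hamiltonian `m = 1` on `t < 0`). -/
theorem structE_of_nonpos (h : IsSuzukiPair ϱ K) (ht : t ≤ 0) (z : ℂ) :
    structE ϱ K t z = cexp (I * z * t) * fourier ϱ z := by
  have hK3 : ∀ u : ℝ, u < 0 → K u = 0 := fun u hu => h.kernel_eq_zero u hu.le
  rw [structE_eq, m_eq_one_of_nonpos hK3 ht]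
  simp only [Complex.ofReal_one, one_mul, inv_one]
  rw [fourier_def, fourier_def, ← integral_add]
  · rw [← fourier_comp_sub ϱ t z, fourier_def]
    refine integral_congr_ae (Eventually.of_forall fun x => ?_)
    simp only
    rw [← add_mul, ← Complex.ofReal_add, frakF_add_frakG_of_nonpos h.kernel_eq_zero h.conv_eq ht x]
  · have e : frakF ϱ K t = fun x => 1 / 2 * (ϱ (x - t) + 1 * ϱ (-x - t)) := by
      funext x; exact frakFG_of_nonpos h.kernel_eq_zero h.conv_eq 1 ht x
    rw [e]
    have h1 := integrable_mul_cexp_of_decay (h.continuous_rho.comp (continuous_id.sub continuous_const))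
      (decay_comp_sub h.abs_rho_le t) z
    have h2 := integrable_mul_cexp_of_decay
      ((h.continuous_rho.comp (continuous_id.sub continuous_const)).comp continuous_neg)
      (decay_comp_neg (decay_comp_sub h.abs_rho_le t)) z
    have e2 : (fun x : ℝ => ((1 / 2 * (ϱ (x - t) + 1 * ϱ (-x - t)) : ℝ) : ℂ) * cexp (I * z * x)) =
        fun x => (1 / 2 : ℂ) * ((ϱ (x - t) : ℂ) * cexp (I * z * x)) +
          (1 / 2 : ℂ) * ((ϱ (-x - t) : ℂ) * cexp (I * z * x)) := by
      funext x; push_cast; ring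
    rw [e2]
    exact (h1.const_mul _).add (h2.const_mul _)
  · have e : frakG ϱ K t = fun x => 1 / 2 * (ϱ (x - t) + (-1) * ϱ (-x - t)) := by
      funext x; exact frakFG_of_nonpos h.kernel_eq_zero h.conv_eq (-1) ht x
    rw [e]
    have h1 := integrable_mul_cexp_of_decay (h.continuous_rho.comp (continuous_id.sub continuous_const))
      (decay_comp_sub h.abs_rho_le t) z
    have h2 := integrable_mul_cexp_of_decay
      ((h.continuous_rho.comp (continuous_id.sub continuous_const)).comp continuous_neg)
      (decay_comp_neg (decay_comp_sub h.abs_rho_le t)) z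
    have e2 : (fun x : ℝ => ((1 / 2 * (ϱ (x - t) + (-1) * ϱ (-x - t)) : ℝ) : ℂ) * cexp (I * z * x)) =
        fun x => (1 / 2 : ℂ) * ((ϱ (x - t) : ℂ) * cexp (I * z * x)) -
          (1 / 2 : ℂ) * ((ϱ (-x - t) : ℂ) * cexp (I * z * x)) := by
      funext x; push_cast; ring
    rw [e2]
    exact (h1.const_mul _).sub (h2.const_mul _)

/-- RH-FREE. **Thm. 3.1 (5) / (3.41): `E(0,z) = E(z)`** with `E = 𝖥ϱ` (K1). -/
theorem structE_zero (h : IsSuzukiPair ϱ K) (z : ℂ) : structE ϱ K 0 z = fourier ϱ z := by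
  rw [structE_of_nonpos h le_rfl z]
  simp

end Summit.RiemannHypothesis.RiemannHypothesis.Theorems.SuzukiStructureFunctions

end
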